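import Summits.Ventures.PercRepro.RankLevelSetLevelSevenPartThree
import Summits.Ventures.PercRepro.S2CubeGiantCount
import Summits.Ventures.PercRepro.RankLevelSetCoreGeneralSharp
import Summits.Ventures.PercRepro.RankLevelSetLevelSixHeavySq39U
import Summits.Ventures.PercRepro.RankLevelSetLevelSevenArithCubeZ
import Summits.Ventures.PercRepro.RankLevelSetLevelSevenCubeTails

/-!
# PercRepro — THEOREM C₇ ON THE PARTITION CHAIN WITH THE CUBIC MULTIPLICITY: C-025 AT LEVEL `7` FOR EVERY FINITE
MATROID AND EVERY `p ≥ 105`, GIVEN LEVEL `6` FROM `104` — UNCONDITIONAL ON THE `39` ROW (p4, gen 16; a feeder for S4)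

The level-`7` partition chain of RankLevelSetLevelSevenPartThree (d2141, the three-multiplicity, `p ≥ 147`) re-assembled on
p7's partition-form giant count with the CUBIC multiplicity `ν + 3·C(ν, 2) + 3·C(ν, 3)` (`S2.ncard_eRk_eq_ncard_le_le_giant_cube'`,
S2CubeGiantCount; `S2.card_spanF_ge_cube`), the same caps `f = min 79 (7 + d)`, `f′ = min 39 (6 + d)`, `ν_∩ = min 33 d`,
LEMMAS T / T4, the 88 polynomial inequalities `level_seven_poly_cube` (RankLevelSetLevelSevenArithCubeA … H, Z; certificate
at `p ≥ 103`, least threshold `93` at `d = 33`), and the large-corank regime with the floor `B + 2`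
(`c025_core_seven_beyond_sharp`, `103 ≤ p`, corank `> 87`). `Y`-side at `p ≥ 104`: for `37 ≤ d ≤ 64` the uniform tails
(`32·F₇(n) ≤ 2^n` from `n ≥ 140`, the `5/2` tail); for `d ≤ 36` the nullity-capped count
`#{r ≤ 7} ≤ (Σ_{j ≤ 7} C(n, j))·2^d` (`ncard_eRk_le_le_sum_choose_mul_of_bound` with `B = 7 + d`) and the crude tail
`256·n^7·2^d ≤ 2^n` (`small_corank_tail_seven`); for `65 ≤ d ≤ 87` the combined numerical bases
`8·tailG d (104 + d) ≤ 2^{104 + d}` (RankLevelSetLevelSevenCubeTails). The exact `Y`-side forces `p ≥ 104` at `d = 87`.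
* **`c025_core_seven_bounded_corank_cube`** — the `e`-free core at level `7`, corank `8 ≤ d ≤ 87`, rank `p ≥ 104`;
* **`c025_seven_of_six_cube`** — level `6` for all `p ≥ 104` implies level `7` for all `p ≥ 105`;
* **`c025_seven_large_cube'`** — UNCONDITIONAL over the tree: level `7` for every `p ≥ 105` (p8's `c025_six_large_thirty_nine`).
Axioms: standard.
-/

open scoped Matroid

namespace PercRepro

namespace ThmN

open Set

variable {α : Type}

set_option maxHeartbeats 800000 in
/-- **The crude tail at small corank**: `256·n^7·2^d ≤ 2^n` for `d ≤ 36` and `n ≥ 103 + d`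
(`256·2^36·m^7 ≤ 2^m` from `m ≥ 139`, applied at `m = n − d + 36`). -/
theorem small_corank_tail_seven (d n : ℕ) (hd : d ≤ 36) (hn : 103 + d ≤ n) :
    32 * (8 * (n ^ 7 * 2 ^ d)) ≤ 2 ^ n := by
  have hbase : ∀ m, 139 ≤ m → 256 * 2 ^ 36 * m ^ 7 ≤ 2 ^ m :=
    mul_pow_le_two_pow_of_base (256 * 2 ^ 36) 7 139 (by norm_num) (by norm_num) (by norm_num)
  have h1 := hbase (n - d + 36) (by omega)
  have h2 : n ^ 7 ≤ (n - d + 36) ^ 7 := Nat.pow_le_pow_left (by omega) 7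
  have h3 : 2 ^ (n - d + 36) = 2 ^ (n - d) * 2 ^ 36 := pow_add 2 _ _
  have h4 : 2 ^ n = 2 ^ (n - d) * 2 ^ d := by rw [← pow_add, Nat.sub_add_cancel (by omega : d ≤ n)]
  have h5 : 256 * n ^ 7 ≤ 2 ^ (n - d) := by
    have h6 : 256 * 2 ^ 36 * n ^ 7 ≤ 2 ^ (n - d) * 2 ^ 36 := by
      calc 256 * 2 ^ 36 * n ^ 7 ≤ 256 * 2 ^ 36 * (n - d + 36) ^ 7 := Nat.mul_le_mul_left _ h2
        _ ≤ 2 ^ (n - d + 36) := h1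
        _ = 2 ^ (n - d) * 2 ^ 36 := h3
    have h7 : 256 * 2 ^ 36 * n ^ 7 = (256 * n ^ 7) * 2 ^ 36 := by ring
    rw [h7] at h6
    exact Nat.le_of_mul_le_mul_right h6 (by positivity)
  calc 32 * (8 * (n ^ 7 * 2 ^ d)) = (256 * n ^ 7) * 2 ^ d := by ring
    _ ≤ 2 ^ (n - d) * 2 ^ d := Nat.mul_le_mul_right _ h5
    _ = 2 ^ n := h4.symm

/-- **The `e`-free core at level `7`, corank `8 ≤ d ≤ 87`, rank `p ≥ 104`** (the partition count with the cubic
multiplicity, the nullity cap, `f(7) ≤ 79`, `f(6) ≤ 39`, Lemmas T and T4; the `Y`-side by the uniform tail for `d ≥ 37` and the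
nullity-capped count with the crude tail for `d ≤ 36`). -/
theorem c025_core_seven_bounded_corank_cube (M : Matroid α) [M.Finite] (p d : ℕ) (hp : 104 ≤ p) (hd8 : 8 ≤ d)
    (hd87 : d ≤ 87) (hR : M.eRank = (p : ℕ∞)) (hn : M.E.ncard = p + d)
    (hfree : ∀ e ∈ M.E, ∃ A ⊆ M.E \ {e}, e ∉ M.closure A ∧ e ∉ M.closure ((M.E \ {e}) \ A)) :
    RLS M p 7 := by
  classical
  have hEcard : M.ground_finite.toFinset.card = p + d := by
    rw [← Set.ncard_eq_toFinset_card _ M.ground_finite]; exact hn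
  -- the core is simple: every circuit has `≥ 3` elements
  have hL0 : ∀ e ∈ M.E, ¬ M.IsLoop e := not_isLoop_of_free M hfree
  have hs : ∀ e ∈ M.E, ∀ f ∈ M.E, e ≠ f → M.eRk {e, f} = 2 := by
    intro e he f hf hef
    have h2 : (2 : ℕ∞) ≤ M.eRk {e, f} :=
      two_le_eRk_of_two_le_ncard_of_free M hfree (pair_subset he hf) (by rw [ncard_pair hef])
    have h3 : M.eRk {e, f} ≤ 2 := by
      have := M.eRk_le_encard {e, f}
      rwa [encard_pair hef] at this
    exact le_antisymm h3 h2
  have hcirc : ∀ C, M.IsCircuit C → 3 ≤ C.encard := three_le_encard_of_circuit M hL0 hs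
  have hd : M.E.encard = M.eRank + d := by
    rw [hR, ← M.ground_finite.cast_ncard_eq, hn]
    push_cast
    ring
  -- the nullity cap: every `X ⊆ E` has `|X| ≤ r(X) + d`
  have hcap : ∀ X ⊆ M.E, ∀ k : ℕ, M.eRk X ≤ k → X.ncard ≤ k + d := by
    intro X hX k hr
    have h1 := Matroid.encard_le_eRk_add_of_encard_eq hX hd
    have h2 : X.encard ≤ (k : ℕ∞) + d := h1.trans (by gcongr)
    have hfin : X.Finite := M.ground_finite.subset hX
    rw [← hfin.cast_ncard_eq] at h2
    exact_mod_cast h2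
  -- rank-`≤ 7` sets have `≤ min 79 (7 + d)` points, rank-`≤ 6` sets `≤ min 39 (6 + d)`
  have hflat : ∀ X ⊆ M.E, M.eRk X ≤ 7 → X.ncard ≤ min 79 (7 + d) :=
    fun X hX hr => le_min (ncard_le_seventynine_of_eRk_le_seven_of_free M hfree X hX hr) (hcap X hX 7 hr)
  have hflat' : ∀ X ⊆ M.E, M.eRk X ≤ ((7 - 1 : ℕ) : ℕ∞) → X.ncard ≤ min 39 (6 + d) :=
    fun X hX hr => le_min (ncard_le_thirtynine_of_eRk_le_six_of_free M hfree hX (by simpa using hr))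
      (hcap X hX 6 (by simpa using hr))
  have hinter := hinter_seven M hd hfree
  -- the circuit counts: Lemma T, Lemma T4, and the nullity bounds
  have hC1 : ∀ L ⊆ M.E, M.eRk L = 2 → L.ncard ≤ 3 :=
    fun L hL hr => ncard_le_three_of_eRk_two M hs hfree hL hr
  have hC1' : ∀ L ⊆ M.E, M.eRk L ≤ 2 → L.ncard ≤ 3 := by
    intro L hL' hr
    have := ncard_add_one_le_two_pow_of_eRk_le M hL0 hfree 2 L hL' hr
    omega
  have hC2 : ∀ P ⊆ M.E, M.eRk P ≤ 3 → P.ncard ≤ 6 :=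
    fun P hP hr => ncard_le_six_of_eRk_le_three_of_free M hfree hP hr
  have hs3 : {C | M.IsCircuit C ∧ C.ncard = 3}.ncard ≤ d * (d + 1) / 2 := by
    have hT : 2 * {C | M.IsCircuit C ∧ C.ncard = 3}.ncard ≤ d * (d + 1) := S1.two_mul_ncard_triangles_le M hC1 hd
    omega
  have hs4 : {C | M.IsCircuit C ∧ C.ncard = 4}.ncard ≤ d * (d + 1) * (d + 2) / 3 := by
    have hT4 : 3 * {C : Set α | M.IsCircuit C ∧ C.ncard = 4}.ncard ≤ d * (d + 1) * (d + 2) :=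
      S1.three_mul_ncard_four_circuits_le M hC1' hC2 hd
    omega
  have hs5 : {C | M.IsCircuit C ∧ C.ncard = 5}.ncard ≤ (d + 4).choose 5 :=
    Matroid.ncard_circuits_le_choose_of_encard M hd 4
  have hs6 : {C | M.IsCircuit C ∧ C.ncard = 6}.ncard ≤ (d + 5).choose 6 :=
    Matroid.ncard_circuits_le_choose_of_encard M hd 5
  have hs7 : {C | M.IsCircuit C ∧ C.ncard = 7}.ncard ≤ (d + 6).choose 7 :=
    Matroid.ncard_circuits_le_choose_of_encard M hd 6
  have hs8 : {C | M.IsCircuit C ∧ C.ncard = 8}.ncard ≤ (d + 7).choose 8 :=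
    Matroid.ncard_circuits_le_choose_of_encard M hd 7
  -- (U): the partition count with the three-multiplicity, in `ℚ`, then the circuit bounds
  have hU0 := S2.ncard_eRk_eq_ncard_le_le_giant_cube' M 7 (min 79 (7 + d)) (min 39 (6 + d)) (max ((d + min 33 d) / 2 + 1) (min 32 (d - 1) + 2)) (min 33 d)
    (by norm_num) hcirc hC1 hflat hflat' hinter hd (by omega) (by omega) (by omega)
  have hU1 := Matroid.topCount_le_ncard_compl (M := M) hR hd 7
  have hm1 : min (min 79 (7 + d) - (7 + 1)) (max ((d + min 33 d) / 2 + 1) (min 32 (d - 1) + 2) - 2) =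
      min 71 (max ((d + min 33 d) / 2 + 1) (min 32 (d - 1) + 2) - 2) := by omega
  have hm2 : min 39 (6 + d) - 7 = min 32 (d - 1) := by omega
  have hm3 : min (min 79 (7 + d)) (7 + d) = min 79 (7 + d) := by omega
  rw [hn, sum_Icc_three_eight_q, sum_Icc_three_eight_q, hm1, hm2, hm3,
    show d - (7 + 1) + 1 = d - 7 by omega] at hU0
  simp only [show (7 : ℕ) + 1 = 8 from rfl, show (8 : ℕ) - 3 = 5 from rfl, show (8 : ℕ) - 4 = 4 from rfl,
    show (8 : ℕ) - 5 = 3 from rfl, show (8 : ℕ) - 6 = 2 from rfl, show (8 : ℕ) - 7 = 1 from rfl,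
    show (8 : ℕ) - 8 = 0 from rfl, Nat.choose_one_right, Nat.choose_zero_right] at hU0
  have hUq : (Matroid.topCount M p 7 : ℚ) ≤ ((p + d).choose 7 : ℚ) +
      (∑ j ∈ Finset.range (d - 7), ((Nat.choose (min 71 (max ((d + min 33 d) / 2 + 1) (min 32 (d - 1) + 2) - 2)) j : ℕ) : ℚ) / (((j + 1) + 3 * (j + 1).choose 2 + 3 * (j + 1).choose 3 : ℕ) : ℚ)) *
        (((d * (d + 1) / 2 : ℕ) : ℚ) * ((p + d).choose 5 : ℚ) + ((d * (d + 1) * (d + 2) / 3 : ℕ) : ℚ) * ((p + d).choose 4 : ℚ) +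
          (((d + 4).choose 5 : ℕ) : ℚ) * ((p + d).choose 3 : ℚ) + (((d + 5).choose 6 : ℕ) : ℚ) * ((p + d).choose 2 : ℚ) +
          (((d + 6).choose 7 : ℕ) : ℚ) * (p + d : ℚ) + (((d + 7).choose 8 : ℕ) : ℚ)) +
      ((∑ j ∈ Finset.range (d - 7), ((Nat.choose (min 79 (7 + d) - 8) j : ℕ) : ℚ) / (((j + 1) + 3 * (j + 1).choose 2 + 3 * (j + 1).choose 3 : ℕ) : ℚ)) -
        (∑ j ∈ Finset.range (d - 7), ((Nat.choose (min 32 (d - 1)) j : ℕ) : ℚ) / (((j + 1) + 3 * (j + 1).choose 2 + 3 * (j + 1).choose 3 : ℕ) : ℚ))) *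
        ((d * (d + 1) / 2 * (min 79 (7 + d)).choose 5 + d * (d + 1) * (d + 2) / 3 * (min 79 (7 + d)).choose 4 +
          (d + 4).choose 5 * (min 79 (7 + d)).choose 3 + (d + 5).choose 6 * (min 79 (7 + d)).choose 2 +
          (d + 6).choose 7 * (min 79 (7 + d)) + (d + 7).choose 8 : ℕ) : ℚ) := by
    have hU1q : (Matroid.topCount M p 7 : ℚ) ≤
        ({B : Set α | B ⊆ M.E ∧ M.eRk B = 7 ∧ B.ncard ≤ d}.ncard : ℚ) := by exact_mod_cast hU1
    have hsm : {C | M.IsCircuit C ∧ C.ncard = 3}.ncard * (p + d).choose 5 +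
        {C | M.IsCircuit C ∧ C.ncard = 4}.ncard * (p + d).choose 4 +
        {C | M.IsCircuit C ∧ C.ncard = 5}.ncard * (p + d).choose 3 +
        {C | M.IsCircuit C ∧ C.ncard = 6}.ncard * (p + d).choose 2 +
        {C | M.IsCircuit C ∧ C.ncard = 7}.ncard * (p + d) + {C | M.IsCircuit C ∧ C.ncard = 8}.ncard * 1 ≤
        d * (d + 1) / 2 * (p + d).choose 5 + d * (d + 1) * (d + 2) / 3 * (p + d).choose 4 +
          (d + 4).choose 5 * (p + d).choose 3 + (d + 5).choose 6 * (p + d).choose 2 +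
          (d + 6).choose 7 * (p + d) + (d + 7).choose 8 := by
      have := hs8
      gcongr
      omega
    have hgg : {C | M.IsCircuit C ∧ C.ncard = 3}.ncard * (min 79 (7 + d)).choose 5 +
        {C | M.IsCircuit C ∧ C.ncard = 4}.ncard * (min 79 (7 + d)).choose 4 +
        {C | M.IsCircuit C ∧ C.ncard = 5}.ncard * (min 79 (7 + d)).choose 3 +
        {C | M.IsCircuit C ∧ C.ncard = 6}.ncard * (min 79 (7 + d)).choose 2 +
        {C | M.IsCircuit C ∧ C.ncard = 7}.ncard * (min 79 (7 + d)) + {C | M.IsCircuit C ∧ C.ncard = 8}.ncard * 1 ≤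
        d * (d + 1) / 2 * (min 79 (7 + d)).choose 5 + d * (d + 1) * (d + 2) / 3 * (min 79 (7 + d)).choose 4 +
          (d + 4).choose 5 * (min 79 (7 + d)).choose 3 + (d + 5).choose 6 * (min 79 (7 + d)).choose 2 +
          (d + 6).choose 7 * (min 79 (7 + d)) + (d + 7).choose 8 := by
      gcongr
      omega
    have hsmq : (({C | M.IsCircuit C ∧ C.ncard = 3}.ncard : ℚ) * ((p + d).choose 5 : ℚ) +
        ({C | M.IsCircuit C ∧ C.ncard = 4}.ncard : ℚ) * ((p + d).choose 4 : ℚ) +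
        ({C | M.IsCircuit C ∧ C.ncard = 5}.ncard : ℚ) * ((p + d).choose 3 : ℚ) +
        ({C | M.IsCircuit C ∧ C.ncard = 6}.ncard : ℚ) * ((p + d).choose 2 : ℚ) +
        ({C | M.IsCircuit C ∧ C.ncard = 7}.ncard : ℚ) * ((p + d : ℕ) : ℚ) +
        ({C | M.IsCircuit C ∧ C.ncard = 8}.ncard : ℚ) * ((1 : ℕ) : ℚ)) ≤
        ((d * (d + 1) / 2 * (p + d).choose 5 + d * (d + 1) * (d + 2) / 3 * (p + d).choose 4 +
          (d + 4).choose 5 * (p + d).choose 3 + (d + 5).choose 6 * (p + d).choose 2 +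
          (d + 6).choose 7 * (p + d) + (d + 7).choose 8 : ℕ) : ℚ) := by exact_mod_cast hsm
    have hggq : (({C | M.IsCircuit C ∧ C.ncard = 3}.ncard : ℚ) * ((min 79 (7 + d)).choose 5 : ℚ) +
        ({C | M.IsCircuit C ∧ C.ncard = 4}.ncard : ℚ) * ((min 79 (7 + d)).choose 4 : ℚ) +
        ({C | M.IsCircuit C ∧ C.ncard = 5}.ncard : ℚ) * ((min 79 (7 + d)).choose 3 : ℚ) +
        ({C | M.IsCircuit C ∧ C.ncard = 6}.ncard : ℚ) * ((min 79 (7 + d)).choose 2 : ℚ) +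
        ({C | M.IsCircuit C ∧ C.ncard = 7}.ncard : ℚ) * ((min 79 (7 + d) : ℕ) : ℚ) +
        ({C | M.IsCircuit C ∧ C.ncard = 8}.ncard : ℚ) * ((1 : ℕ) : ℚ)) ≤
        ((d * (d + 1) / 2 * (min 79 (7 + d)).choose 5 + d * (d + 1) * (d + 2) / 3 * (min 79 (7 + d)).choose 4 +
          (d + 4).choose 5 * (min 79 (7 + d)).choose 3 + (d + 5).choose 6 * (min 79 (7 + d)).choose 2 +
          (d + 6).choose 7 * (min 79 (7 + d)) + (d + 7).choose 8 : ℕ) : ℚ) := by exact_mod_cast hgg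
    -- `σ_s ≤ σ_g` (termwise), so the giant excess is non-negative
    have hσ : (∑ j ∈ Finset.range (d - 7), ((Nat.choose (min 32 (d - 1)) j : ℕ) : ℚ) / (((j + 1) + 3 * (j + 1).choose 2 + 3 * (j + 1).choose 3 : ℕ) : ℚ)) ≤
        ∑ j ∈ Finset.range (d - 7), ((Nat.choose (min 79 (7 + d) - 8) j : ℕ) : ℚ) / (((j + 1) + 3 * (j + 1).choose 2 + 3 * (j + 1).choose 3 : ℕ) : ℚ) := by
      apply Finset.sum_le_sum
      intro j _
      have : (min 32 (d - 1)).choose j ≤ (min 79 (7 + d) - 8).choose j := Nat.choose_le_choose j (by omega)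
      have h' : ((min 32 (d - 1)).choose j : ℚ) ≤ ((min 79 (7 + d) - 8).choose j : ℚ) := by exact_mod_cast this
      exact div_le_div_of_nonneg_right h' (by positivity)
    have hσm0 : (0 : ℚ) ≤ ∑ j ∈ Finset.range (d - 7), ((Nat.choose (min 71 (max ((d + min 33 d) / 2 + 1) (min 32 (d - 1) + 2) - 2)) j : ℕ) : ℚ) / (((j + 1) + 3 * (j + 1).choose 2 + 3 * (j + 1).choose 3 : ℕ) : ℚ) :=
      Finset.sum_nonneg (fun j _ => by positivity)
    refine hU1q.trans (hU0.trans ?_)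
    have e1 := mul_le_mul_of_nonneg_left hsmq hσm0
    have e2 := mul_le_mul_of_nonneg_left hggq (by linarith : (0 : ℚ) ≤
      (∑ j ∈ Finset.range (d - 7), ((Nat.choose (min 79 (7 + d) - 8) j : ℕ) : ℚ) / (((j + 1) + 3 * (j + 1).choose 2 + 3 * (j + 1).choose 3 : ℕ) : ℚ)) -
        (∑ j ∈ Finset.range (d - 7), ((Nat.choose (min 32 (d - 1)) j : ℕ) : ℚ) / (((j + 1) + 3 * (j + 1).choose 2 + 3 * (j + 1).choose 3 : ℕ) : ℚ)))
    push_cast at e1 e2 ⊢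
    linarith
  -- (Y): the rank-`≤ 7` sets through their closures; the spanning sets by the `5/2` tail
  have hY := Matroid.two_pow_le_midCount_add (M := M) p 7 hR
  have hsum7 := S2.ncard_eRk_le_le_sum M 7
  simp only [Finset.sum_range_succ, Finset.sum_range_zero, zero_add] at hsum7
  have hB := Matroid.ncard_spanning_le (M := M) hd
  rw [hEcard] at hY hB
  have hAB : 8 * ({X : Set α | X ⊆ M.E ∧ M.eRk X ≤ 7}.ncard +
      {X : Set α | X ⊆ M.E ∧ M.eRk X = M.eRank}.ncard) ≤ 2 ^ (p + d) := by
    rcases Nat.lt_or_ge d 37 with hsmall | hmid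
    · -- `d ≤ 36`: the nullity-capped count and the crude tail
      have hA := ncard_eRk_le_le_sum_choose_mul_of_bound M 7 (7 + d)
        (fun j _ X hX hr => by have := hcap X hX j hr; omega)
      rw [hEcard, show 7 + d - 7 = d by omega] at hA
      have hS := sum_choose_le_mul_pow (p + d) 7 (by omega)
      have hA' : {X : Set α | X ⊆ M.E ∧ M.eRk X ≤ 7}.ncard ≤ 8 * ((p + d) ^ 7 * 2 ^ d) := by
        calc _ ≤ (∑ j ∈ Finset.range (7 + 1), (p + d).choose j) * 2 ^ d := hA
          _ ≤ ((7 + 1) * (p + d) ^ 7) * 2 ^ d := Nat.mul_le_mul_right _ hS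
          _ = 8 * ((p + d) ^ 7 * 2 ^ d) := by ring
      have hT1 := small_corank_tail_seven d (p + d) (by omega) (by omega)
      have hT2 : 16 * ∑ j ∈ Finset.range (d + 1), (p + d).choose j ≤ 2 ^ (p + d) :=
        Explicit.sixteen_mul_sum_range_choose_le' d (p + d) (by omega)
      set X := (p + d) ^ 7 * 2 ^ d with hX
      omega
    rcases Nat.lt_or_ge d 65 with hmid' | hhigh
    · -- `37 ≤ d ≤ 64`, so `n ≥ 140` and `5d + 14 ≤ 2n`: the uniform tails
      have h7 : {X : Set α | X ⊆ M.E ∧ M.eRk X = (7 : ℕ)}.ncard ≤ M.E.ncard.choose 7 * 2 ^ (79 - 7) :=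
        S2.ncard_eRk_eq_le_choose_mul_two_pow M 7 79
          (fun X hX hr => ncard_le_seventynine_of_eRk_le_seven_of_free M hfree X hX (by exact_mod_cast hr))
      have h6 : {X : Set α | X ⊆ M.E ∧ M.eRk X = (6 : ℕ)}.ncard ≤ M.E.ncard.choose 6 * 2 ^ (39 - 6) :=
        S2.ncard_eRk_eq_le_choose_mul_two_pow M 6 39
          (fun X hX hr => ncard_le_thirtynine_of_eRk_le_six_of_free M hfree hX (by exact_mod_cast hr))
      have h5 : {X : Set α | X ⊆ M.E ∧ M.eRk X = (5 : ℕ)}.ncard ≤ M.E.ncard.choose 5 * 2 ^ (19 - 5) :=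
        S2.ncard_eRk_eq_le_choose_mul_two_pow M 5 19
          (fun X hX hr => ncard_le_nineteen_of_eRk_le_five_of_free M hfree hX (by exact_mod_cast hr))
      have h4 : {X : Set α | X ⊆ M.E ∧ M.eRk X = (4 : ℕ)}.ncard ≤ M.E.ncard.choose 4 * 2 ^ (10 - 4) :=
        S2.ncard_eRk_eq_le_choose_mul_two_pow M 4 10
          (fun X hX hr => ncard_le_ten_of_eRk_le_four_of_free M hfree hX (by exact_mod_cast hr))
      have h3 : {X : Set α | X ⊆ M.E ∧ M.eRk X = (3 : ℕ)}.ncard ≤ M.E.ncard.choose 3 * 2 ^ (6 - 3) :=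
        S2.ncard_eRk_eq_le_choose_mul_two_pow M 3 6
          (fun X hX hr => ncard_le_six_of_eRk_le_three_of_free M hfree hX (by exact_mod_cast hr))
      have h2 : {X : Set α | X ⊆ M.E ∧ M.eRk X = (2 : ℕ)}.ncard ≤ M.E.ncard.choose 2 * 2 ^ (3 - 2) :=
        S2.ncard_eRk_eq_le_choose_mul_two_pow M 2 3
          (fun X hX hr => by
            have := ncard_add_one_le_two_pow_of_eRk_le M hL0 hfree 2 X hX hr
            omega)
      have h1 : {X : Set α | X ⊆ M.E ∧ M.eRk X = (1 : ℕ)}.ncard ≤ M.E.ncard.choose 1 * 2 ^ (1 - 1) :=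
        S2.ncard_eRk_eq_le_choose_mul_two_pow M 1 1
          (fun X hX hr => by
            have := ncard_add_one_le_two_pow_of_eRk_le M hL0 hfree 1 X hX hr
            omega)
      have h0 : {X : Set α | X ⊆ M.E ∧ M.eRk X = (0 : ℕ)}.ncard ≤ M.E.ncard.choose 0 * 2 ^ (0 - 0) :=
        S2.ncard_eRk_eq_le_choose_mul_two_pow M 0 0
          (fun X hX hr => by
            have := ncard_add_one_le_two_pow_of_eRk_le M hL0 hfree 0 X hX hr
            omega)
      norm_num [Nat.choose_one_right] at h7 h6 h5 h4 h3 h2 h1 h0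
      rw [hn] at h7 h6 h5 h4 h3 h2 h1
      have hA : {X : Set α | X ⊆ M.E ∧ M.eRk X ≤ 7}.ncard ≤
          (p + d).choose 7 * 2 ^ 72 + (p + d).choose 6 * 2 ^ 33 + (p + d).choose 5 * 2 ^ 14 + (p + d).choose 4 * 2 ^ 6 +
            (p + d).choose 3 * 2 ^ 3 + (p + d).choose 2 * 2 + (p + d) + 1 := by
        push_cast at hsum7
        omega
      -- the tails: `32·F₇(n) ≤ 2^n` from `n ≥ 140`; `16·Σ_{j ≤ d} C(n, j) ≤ 2^n` from `5d + 14 ≤ 2n`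
      have hT1 := thirtytwo_mul_flatTail_seven_le (p + d) (by omega)
      have hT2 : 16 * ∑ j ∈ Finset.range (d + 1), (p + d).choose j ≤ 2 ^ (p + d) :=
        Explicit.sixteen_mul_sum_range_choose_le' d (p + d) (by omega)
      omega
    · -- `65 ≤ d ≤ 87`: the combined numerical bases
      have h7 : {X : Set α | X ⊆ M.E ∧ M.eRk X = (7 : ℕ)}.ncard ≤ M.E.ncard.choose 7 * 2 ^ (min 72 d) := by
        have := S2.ncard_eRk_eq_le_choose_mul_two_pow M 7 (min 79 (7 + d))
          (fun X hX hr => hflat X hX (by exact_mod_cast hr))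
        rwa [show min 79 (7 + d) - 7 = min 72 d by omega] at this
      have h6 : {X : Set α | X ⊆ M.E ∧ M.eRk X = (6 : ℕ)}.ncard ≤ M.E.ncard.choose 6 * 2 ^ (39 - 6) :=
        S2.ncard_eRk_eq_le_choose_mul_two_pow M 6 39
          (fun X hX hr => ncard_le_thirtynine_of_eRk_le_six_of_free M hfree hX (by exact_mod_cast hr))
      have h5 : {X : Set α | X ⊆ M.E ∧ M.eRk X = (5 : ℕ)}.ncard ≤ M.E.ncard.choose 5 * 2 ^ (19 - 5) :=
        S2.ncard_eRk_eq_le_choose_mul_two_pow M 5 19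
          (fun X hX hr => ncard_le_nineteen_of_eRk_le_five_of_free M hfree hX (by exact_mod_cast hr))
      have h4 : {X : Set α | X ⊆ M.E ∧ M.eRk X = (4 : ℕ)}.ncard ≤ M.E.ncard.choose 4 * 2 ^ (10 - 4) :=
        S2.ncard_eRk_eq_le_choose_mul_two_pow M 4 10
          (fun X hX hr => ncard_le_ten_of_eRk_le_four_of_free M hfree hX (by exact_mod_cast hr))
      have h3 : {X : Set α | X ⊆ M.E ∧ M.eRk X = (3 : ℕ)}.ncard ≤ M.E.ncard.choose 3 * 2 ^ (6 - 3) :=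
        S2.ncard_eRk_eq_le_choose_mul_two_pow M 3 6
          (fun X hX hr => ncard_le_six_of_eRk_le_three_of_free M hfree hX (by exact_mod_cast hr))
      have h2 : {X : Set α | X ⊆ M.E ∧ M.eRk X = (2 : ℕ)}.ncard ≤ M.E.ncard.choose 2 * 2 ^ (3 - 2) :=
        S2.ncard_eRk_eq_le_choose_mul_two_pow M 2 3
          (fun X hX hr => by
            have := ncard_add_one_le_two_pow_of_eRk_le M hL0 hfree 2 X hX hr
            omega)
      have h1 : {X : Set α | X ⊆ M.E ∧ M.eRk X = (1 : ℕ)}.ncard ≤ M.E.ncard.choose 1 * 2 ^ (1 - 1) :=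
        S2.ncard_eRk_eq_le_choose_mul_two_pow M 1 1
          (fun X hX hr => by
            have := ncard_add_one_le_two_pow_of_eRk_le M hL0 hfree 1 X hX hr
            omega)
      have h0 : {X : Set α | X ⊆ M.E ∧ M.eRk X = (0 : ℕ)}.ncard ≤ M.E.ncard.choose 0 * 2 ^ (0 - 0) :=
        S2.ncard_eRk_eq_le_choose_mul_two_pow M 0 0
          (fun X hX hr => by
            have := ncard_add_one_le_two_pow_of_eRk_le M hL0 hfree 0 X hX hr
            omega)
      simp only [Nat.choose_one_right, Nat.choose_zero_right, Nat.sub_self, pow_zero, mul_one] at h1 h0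
      rw [hn] at h7 h6 h5 h4 h3 h2 h1
      have hT := eight_mul_tailG_le_cube_seven d (p + d) (by omega) (by omega) (by omega)
      push_cast at hsum7 h7 h6 h5 h4 h3 h2 h1 h0
      have hA : {X : Set α | X ⊆ M.E ∧ M.eRk X ≤ 7}.ncard ≤
          (p + d).choose 7 * 2 ^ (min 72 d) + (p + d).choose 6 * 2 ^ 33 + (p + d).choose 5 * 2 ^ 14 +
            (p + d).choose 4 * 2 ^ 6 + (p + d).choose 3 * 2 ^ 3 + (p + d).choose 2 * 2 + (p + d) + 1 := by
        omega
      omega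
  -- (Φ) and the polynomial inequality
  have hΦ := phiK_le_two_pow_div p 7
  rw [Nat.choose_symm_add] at hΦ
  have hpolyq := level_seven_poly_cube d hd8 (by omega) p (by omega)
  rw [add_assoc] at hpolyq hUq
  -- assemble in `ℚ`
  rw [RLS_iff]
  have hYq : (2 : ℚ) ^ (p + d) ≤ (Matroid.midCount M p 7 : ℚ) +
      ({X : Set α | X ⊆ M.E ∧ M.eRk X ≤ 7}.ncard : ℚ) +
      ({X : Set α | X ⊆ M.E ∧ M.eRk X = M.eRank}.ncard : ℚ) := by exact_mod_cast hY
  have hABq : 8 * (({X : Set α | X ⊆ M.E ∧ M.eRk X ≤ 7}.ncard : ℚ) +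
      ({X : Set α | X ⊆ M.E ∧ M.eRk X = M.eRank}.ncard : ℚ)) ≤ 2 ^ (p + d) := by exact_mod_cast hAB
  have hU0' : (0 : ℚ) ≤ (Matroid.topCount M p 7 : ℚ) := Nat.cast_nonneg _
  have hd7 : 7 ≤ d := by omega
  exact level_arith (p := p) (d := d) (n := p + d) (q := 7) rfl hd7 hΦ hU0' hUq hYq hABq hpolyq

/-- **THEOREM C₇ ON THE CUBIC PARTITION CHAIN, GIVEN LEVEL `6` FROM `104`**: level `6` for all `p ≥ 104` implies
level `7` for all `p ≥ 105`. -/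
theorem c025_seven_of_six_cube (h6 : ∀ (M : Matroid α) [M.Finite] (p : ℕ), 104 ≤ p → RLS M p 6) :
    ∀ (M : Matroid α) [M.Finite] (p : ℕ), 105 ≤ p → RLS M p 7 := by
  intro M _ p hp
  refine rls_succ_large (α := α) 6 7 104 ?_ ?_ ?_ M p hp (by omega)
  · -- level `6` for `p ≥ 104`
    intro M' _ p' hP _
    exact h6 M' p' (by omega)
  · -- corank `≤ 7`: `U = ∅` or Theorem M
    intro M' _ p' _ hn _
    rcases Nat.lt_or_ge M'.E.ncard (p' + 7) with h | h
    · exact RLS_of_ncard_lt M' h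
    · exact RLS_of_ncard_eq M' (by omega)
  · -- the core: coranks `8 … 87` by counting, coranks `≥ 88` by the sharp large-corank theorem
    intro M' _ p' hP hR hbig _ hfree
    rcases Nat.lt_or_ge M'.E.ncard (p' + 88) with h | h
    · exact c025_core_seven_bounded_corank_cube M' p' (M'.E.ncard - p') hP (by omega) (by omega) hR (by omega) hfree
    · exact c025_core_seven_beyond_sharp M' p' (by omega) hR (by omega) hfree

/-- **THEOREM C₇ ON THE CUBIC PARTITION CHAIN, GIVEN LEVEL `6` FROM `P`**: for every `P ≥ 104`, level `6` for all
`p ≥ P` implies level `7` for all `p ≥ P + 1`. -/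
theorem c025_seven_of_six_cube_from (P : ℕ) (hP : 104 ≤ P)
    (h6 : ∀ (M : Matroid α) [M.Finite] (p : ℕ), P ≤ p → RLS M p 6) :
    ∀ (M : Matroid α) [M.Finite] (p : ℕ), P + 1 ≤ p → RLS M p 7 := by
  intro M _ p hp
  refine rls_succ_large (α := α) 6 7 P ?_ ?_ ?_ M p hp (by omega)
  · intro M' _ p' hP' _
    exact h6 M' p' hP'
  · intro M' _ p' _ hn _
    rcases Nat.lt_or_ge M'.E.ncard (p' + 7) with h | h
    · exact RLS_of_ncard_lt M' h
    · exact RLS_of_ncard_eq M' (by omega)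
  · intro M' _ p' hP' hR hbig _ hfree
    rcases Nat.lt_or_ge M'.E.ncard (p' + 88) with h | h
    · exact c025_core_seven_bounded_corank_cube M' p' (M'.E.ncard - p') (by omega) (by omega) (by omega) hR
        (by omega) hfree
    · exact c025_core_seven_beyond_sharp M' p' (by omega) hR (by omega) hfree

/-- **THEOREM C₇ AT `105`, UNCONDITIONAL OVER THE TREE**: every finite matroid satisfies C-025 at level `7` for every
`p ≥ 105` — p8's `c025_six_large_thirty_nine` (level `6` for `p ≥ 39`, ADDENDUM 48) through the wrapper at `P = 104`. -/
theorem c025_seven_large_cube' (M : Matroid α) [M.Finite] (p : ℕ) (hp : 105 ≤ p) : RLS M p 7 :=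
  c025_seven_of_six_cube_from 104 (by norm_num)
    (fun M' _ p' hp' => c025_six_large_thirty_nine M' p' (by omega)) M p hp

/-- The same in the literal `C025` body: `phiK p 7 · #U(p, 7) ≤ #Y(p, 7)` for every finite matroid and every `p ≥ 105`. -/
theorem c025_seven_large_cube (M : Matroid α) [M.Finite] (p : ℕ) (hp : 105 ≤ p) :
    phiK p 7 * ({A : Set α | A ⊆ M.E ∧ M.eRk A = (p : ℕ∞) ∧ M.eRk (M.E \ A) = (7 : ℕ∞)}.ncard : ℚ) ≤
      ({A : Set α | A ⊆ M.E ∧ (7 : ℕ∞) < M.eRk A ∧ M.eRk A < (p : ℕ∞)}.ncard : ℚ) :=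
  c025_seven_large_cube' M p hp

end ThmN

end PercRepro
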